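import Summits.AtomisticToContinuum.FouriersLaw.Theorems.HonestZwanzigNetworkReductionRobin

/-!
# HonestZwanzig / NetworkReduction — the finite-dimensional circuit algebra

Support file for item `stmt-AtomisticToContinuum-12701` (`NetworkReduction` of route `HonestZwanzig`,
sub-problem `FouriersLaw`). Pure finite-dimensional linear algebra over `Fin N`, stated for
ABSTRACT pairings `lap, cov : (X → ℝ) → (X → ℝ) → ℝ` (the Laplace-transformed equilibrium
correlation at one fixed `s > 0` and the static covariance) and abstract observables `e x` (site
energies), `j b` (bond currents), `J` (total current), `psq y` (`p_y²`), `Lf y` (`L e_y`) and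
`Lr y` (`(L e_y)∘Θ`); the chain enters only through the finitely many identities listed as
hypotheses of `circuit_sandwich` (symmetry and positivity of `G = [lap(e_x,e_y)]` and
`C = [cov(e_x,e_y)]`, time reversal on the current, the Kolmogorov identities, the bond
decomposition of `(L e_y)∘Θ`). Results: `posDef_of_symm_of_pos` (real symmetric + positive form ⇒
`Matrix.PosDef`), `schur_lincomb` (linearity of `f ↦ schur(f,J)`), and `circuit_sandwich`: the exact
circuit formula `lap(J,J) = Σ_b schur(j_b,J) − aᵀG⁻¹a`, `a_x = lap(J,e_x)`, with
`0 ≤ aᵀG⁻¹a = ξᵀ𝔽ξ = 2m·ξ − ξᵀ𝔽ξ` (`𝔽 = C G⁻¹ C`, `ξ = C⁻¹a`, `m = C G⁻¹ a = −schur(Lr y, J)`),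
whence under Robin coercivity of `𝔽` the two-sided bound
`Σ_b σ_b − c⁻¹(Σ_{b+1<N}(σ_b − k)² + (γτ_0 − k)² + (γτ_{N−1} + k)²) ≤ lap(J,J) ≤ Σ_b σ_b`.
-/

namespace Summit.AtomisticToContinuum.FouriersLaw.Theorems.HonestZwanzig.NetworkReduction

open Finset Matrix

/-! ### Real symmetric matrices with positive quadratic form -/

/-- The double sum `Σ_x Σ_y v_x M_{xy} v_y` is the quadratic form `v ⬝ᵥ (M *ᵥ v)`. -/
theorem sum_sum_eq_dotProduct_mulVec {n : Type*} [Fintype n] (M : Matrix n n ℝ) (v w : n → ℝ) :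
    (∑ x, ∑ y, v x * M x y * w y) = v ⬝ᵥ (M *ᵥ w) := by
  simp only [dotProduct, mulVec, Finset.mul_sum, mul_assoc]

/-- A real matrix which is symmetric and has positive quadratic form on nonzero vectors is
positive definite in Mathlib's sense. -/
theorem posDef_of_symm_of_pos {n : Type*} [Fintype n] (M : Matrix n n ℝ)
    (hsymm : ∀ x y, M x y = M y x) (hpos : ∀ v : n → ℝ, v ≠ 0 → 0 < ∑ x, ∑ y, v x * M x y * v y) :
    M.PosDef := by
  refine Matrix.PosDef.of_dotProduct_mulVec_pos ?_ ?_
  · refine Matrix.IsHermitian.ext fun i j => ?_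
    rw [star_trivial, hsymm]
  · intro v hv
    rw [star_trivial, ← sum_sum_eq_dotProduct_mulVec]
    exact hpos v hv

/-- The transpose of a symmetric matrix. -/
theorem transpose_eq_of_symm {n : Type*} [Fintype n] (M : Matrix n n ℝ)
    (hsymm : ∀ x y, M x y = M y x) : Mᵀ = M := by
  ext i j
  exact hsymm j i

/-- Entries of a triple product as a double sum. -/
theorem mul_mul_apply_eq_sum_sum {n : Type*} [Fintype n] (A M B : Matrix n n ℝ) (x y : n) :
    (A * M * B) x y = ∑ u, ∑ v, A x u * M u v * B v y := by
  simp only [Matrix.mul_apply, Finset.sum_mul]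
  rw [Finset.sum_comm]

/-- For a symmetric matrix, `ξ ⬝ᵥ (C *ᵥ w) = (C *ᵥ ξ) ⬝ᵥ w`. -/
theorem dotProduct_mulVec_of_symm {n : Type*} [Fintype n] (C : Matrix n n ℝ)
    (hsymm : ∀ x y, C x y = C y x) (ξ w : n → ℝ) : ξ ⬝ᵥ (C *ᵥ w) = (C *ᵥ ξ) ⬝ᵥ w := by
  rw [dotProduct_mulVec, ← Matrix.mulVec_transpose, transpose_eq_of_symm C hsymm]

/-! ### The circuit formula and the two-sided bound (abstract pairings at one fixed `s`) -/

section Circuit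

variable {X : Type*} {N : ℕ}
  (lap cov schur : (X → ℝ) → (X → ℝ) → ℝ) (e j psq Lf Lr : Fin N → X → ℝ) (J : X → ℝ)
  (G C : Matrix (Fin N) (Fin N) ℝ) (F : Fin N → Fin N → ℝ) (s γ : ℝ)

/-- Linearity of `f ↦ schur(f, J)` along a finite linear relation valid against `J` and every `e u`. -/
theorem schur_lincomb
    (hschur : ∀ f g, schur f g = lap f g - ∑ x, ∑ y, lap f (e x) * G⁻¹ x y * lap (e y) g)
    (w : Fin N → ℝ) (w₀ : ℝ) (f f₀ : X → ℝ) (fs : Fin N → X → ℝ)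
    (hJ : lap f J = (∑ b, w b * lap (fs b) J) + w₀ * lap f₀ J)
    (he : ∀ u, lap f (e u) = (∑ b, w b * lap (fs b) (e u)) + w₀ * lap f₀ (e u)) :
    schur f J = (∑ b, w b * schur (fs b) J) + w₀ * schur f₀ J := by
  simp only [hschur]
  rw [hJ]
  simp_rw [he]
  have h1 : ∀ x y, ((∑ b, w b * lap (fs b) (e x)) + w₀ * lap f₀ (e x)) * G⁻¹ x y * lap (e y) J =
      (∑ b, w b * (lap (fs b) (e x) * G⁻¹ x y * lap (e y) J)) +
        w₀ * (lap f₀ (e x) * G⁻¹ x y * lap (e y) J) := by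
    intro x y
    rw [add_mul, add_mul, Finset.sum_mul, Finset.sum_mul]
    congr 1
    · refine Finset.sum_congr rfl fun b _ => ?_
      ring
    · ring
  simp_rw [h1]
  simp only [Finset.sum_add_distrib, ← Finset.mul_sum, mul_sub, Finset.sum_sub_distrib]
  have h2 : ∑ x, ∑ y, ∑ b, w b * (lap (fs b) (e x) * G⁻¹ x y * lap (e y) J) =
      ∑ b, w b * ∑ x, ∑ y, lap (fs b) (e x) * G⁻¹ x y * lap (e y) J := by
    symm
    simp only [Finset.mul_sum]
    rw [Finset.sum_comm]
    refine Finset.sum_congr rfl fun x _ => ?_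
    rw [Finset.sum_comm]
  rw [h2]
  ring

/-- **The circuit sandwich.** Under the finitely many fixed-`s` identities of the Feshbach block
algebra (symmetry/positivity of `G` and `C`, time reversal on the current, the Kolmogorov
identities, the bond decomposition of `(L e_y)∘Θ`) and Robin coercivity of
`𝔽_{xy} = s·C_{xy} − cov(e_x, L e_y) − schur((L e_x)∘Θ, L e_y)` with constant `c`:
`Σ_b σ_b − c⁻¹ (Σ_{b+1<N} (σ_b − k)² + (γτ_0 − k)² + (γτ_{N−1} + k)²) ≤ lap(J,J) ≤ Σ_b σ_b`
for every real `k`, where `σ_b = schur(j_b, J)` and `τ_y = schur(p_y², J)`. -/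
theorem circuit_sandwich (hN : 2 ≤ N)
    (hG : ∀ x y, G x y = lap (e x) (e y)) (hC : ∀ x y, C x y = cov (e x) (e y))
    (hschur : ∀ f g, schur f g = lap f g - ∑ x, ∑ y, lap f (e x) * G⁻¹ x y * lap (e y) g)
    (hF : ∀ x y, F x y = s * cov (e x) (e y) - cov (e x) (Lf y) - schur (Lr x) (Lf y))
    (hGs : ∀ x y, lap (e x) (e y) = lap (e y) (e x))
    (hGp : ∀ v : Fin N → ℝ, v ≠ 0 → 0 < ∑ x, ∑ y, v x * G x y * v y)
    (hCs : ∀ x y, cov (e x) (e y) = cov (e y) (e x))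
    (hCp : ∀ v : Fin N → ℝ, v ≠ 0 → 0 < ∑ x, ∑ y, v x * cov (e x) (e y) * v y)
    (hrev : ∀ x, lap (e x) J = -lap J (e x))
    (hK1 : ∀ x u, lap (Lr x) (e u) = s * lap (e x) (e u) - cov (e x) (e u))
    (hK2 : ∀ u y, lap (e u) (Lf y) = s * lap (e u) (e y) - cov (e u) (e y))
    (hK3 : ∀ x y, lap (Lr x) (Lf y) = s * (s * lap (e x) (e y) - cov (e x) (e y)) - cov (e x) (Lf y))
    (hK4 : ∀ y, lap (Lr y) J = -(s * lap J (e y)))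
    (hLrJ : ∀ y, lap (Lr y) J =
      (∑ b, ((if b = y then 1 else 0) - (if y.val = b.val + 1 then 1 else 0)) * lap (j b) J) +
        (-(γ * ((if y.val = 0 then 1 else 0) + (if y.val = N - 1 then 1 else 0)))) * lap (psq y) J)
    (hLre : ∀ y u, lap (Lr y) (e u) =
      (∑ b, ((if b = y then 1 else 0) - (if y.val = b.val + 1 then 1 else 0)) * lap (j b) (e u)) +
        (-(γ * ((if y.val = 0 then 1 else 0) + (if y.val = N - 1 then 1 else 0)))) * lap (psq y) (e u))
    (hJJ : lap J J = ∑ b, lap (j b) J) (hJe : ∀ u, lap J (e u) = ∑ b, lap (j b) (e u))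
    (hjN : ∀ b : Fin N, ¬ b.val + 1 < N → lap (j b) J = 0 ∧ ∀ u, lap (j b) (e u) = 0)
    {c : ℝ} (hc : 0 < c)
    (hRobin : ∀ ξ : Fin N → ℝ, c * (∑ i : Fin N, ((∑ j : Fin N,
        if j.val = i.val + 1 then (ξ j - ξ i) ^ 2 else 0) + (if i.val = 0 then ξ i ^ 2 else 0) +
        (if i.val = N - 1 then ξ i ^ 2 else 0))) ≤ ∑ x, ∑ y, ξ x * F x y * ξ y)
    (k : ℝ) :
    (∑ b, schur (j b) J) - (1 / c) * ((∑ b : Fin N, if b.val + 1 < N then (schur (j b) J - k) ^ 2 else 0)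
        + (γ * schur (psq ⟨0, by omega⟩) J - k) ^ 2 + (γ * schur (psq ⟨N - 1, by omega⟩) J + k) ^ 2)
      ≤ lap J J ∧ lap J J ≤ ∑ b, schur (j b) J := by
  classical
  -- the two Gram matrices
  have hGsym : ∀ x y, G x y = G y x := fun x y => by rw [hG, hG, hGs]
  have hCsym : ∀ x y, C x y = C y x := fun x y => by rw [hC, hC, hCs]
  have hGpd : G.PosDef := posDef_of_symm_of_pos G hGsym hGp
  have hCpd : C.PosDef := posDef_of_symm_of_pos C hCsym (fun v hv => by
    have := hCp v hv
    simpa only [hC] using this)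
  have hGu : IsUnit G.det := (Matrix.isUnit_iff_isUnit_det G).1 hGpd.isUnit
  have hCu : IsUnit C.det := (Matrix.isUnit_iff_isUnit_det C).1 hCpd.isUnit
  have hGG : G * G⁻¹ = 1 := Matrix.mul_nonsing_inv G hGu
  have hGG' : G⁻¹ * G = 1 := Matrix.nonsing_inv_mul G hGu
  have hCC : C * C⁻¹ = 1 := Matrix.mul_nonsing_inv C hCu
  -- the vector `a_x = lap(J, e_x)`
  set a : Fin N → ℝ := fun x => lap J (e x) with ha
  -- (1) schur(J,J) = lap(J,J) + aᵀ G⁻¹ a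
  have h1 : schur J J = lap J J + a ⬝ᵥ (G⁻¹ *ᵥ a) := by
    rw [hschur, ← sum_sum_eq_dotProduct_mulVec]
    have : ∀ x y, lap J (e x) * G⁻¹ x y * lap (e y) J = -(a x * G⁻¹ x y * a y) := by
      intro x y
      rw [hrev, ha]
      ring
    simp_rw [this]
    simp only [Finset.sum_neg_distrib, sub_neg_eq_add]
  -- (2) aᵀ G⁻¹ a ≥ 0
  have h2 : 0 ≤ a ⬝ᵥ (G⁻¹ *ᵥ a) := by
    have := hGpd.inv.posSemidef.dotProduct_mulVec_nonneg a
    rwa [star_trivial] at this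
  -- (3) schur(J,J) = Σ_b schur(j_b, J)
  have h3 : schur J J = ∑ b, schur (j b) J := by
    have := schur_lincomb lap schur e J G hschur (fun _ => 1) 0 J J j
      (by rw [hJJ]; simp) (fun u => by rw [hJe]; simp)
    rw [this]
    simp
  -- (4) 𝔽 = C G⁻¹ C entrywise
  have h4 : ∀ x y, F x y = (C * G⁻¹ * C) x y := by
    intro x y
    rw [hF, hschur, hK3]
    have hT : ∀ u v, lap (Lr x) (e u) * G⁻¹ u v * lap (e v) (Lf y) =
        (s • G - C) x u * G⁻¹ u v * (s • G - C) v y := by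
      intro u v
      rw [hK1, hK2]
      simp only [Matrix.sub_apply, Matrix.smul_apply, smul_eq_mul, hG, hC]
    have hT' : ∑ u, ∑ v, lap (Lr x) (e u) * G⁻¹ u v * lap (e v) (Lf y) =
        ((s • G - C) * G⁻¹ * (s • G - C)) x y := by
      rw [mul_mul_apply_eq_sum_sum]
      exact Finset.sum_congr rfl fun u _ => Finset.sum_congr rfl fun v _ => hT u v
    rw [hT']
    have hmat : (s • G - C) * G⁻¹ * (s • G - C) =
        (s * s) • G - s • C - s • C + C * G⁻¹ * C := by
      have e1 : (s • G - C) * G⁻¹ = s • (1 : Matrix (Fin N) (Fin N) ℝ) - C * G⁻¹ := by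
        rw [sub_mul, Matrix.smul_mul, hGG]
      rw [e1, sub_mul, mul_sub, mul_sub, Matrix.smul_mul, Matrix.smul_mul, Matrix.one_mul,
        Matrix.one_mul, smul_smul, Matrix.mul_smul, Matrix.mul_assoc C G⁻¹ G, hGG', Matrix.mul_one]
      abel
    rw [hmat]
    simp only [Matrix.add_apply, Matrix.sub_apply, Matrix.smul_apply, smul_eq_mul]
    rw [hG x y, hC x y]
    ring
  -- (5) the variational identity aᵀG⁻¹a = 2 m·ξ − ξᵀ𝔽ξ with ξ = C⁻¹ a, m = C G⁻¹ a
  set ξ : Fin N → ℝ := C⁻¹ *ᵥ a with hξ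
  set m : Fin N → ℝ := C *ᵥ (G⁻¹ *ᵥ a) with hm
  have hCξ : C *ᵥ ξ = a := by
    rw [hξ, Matrix.mulVec_mulVec, hCC, Matrix.one_mulVec]
  have hquad : ∑ x, ∑ y, ξ x * F x y * ξ y = a ⬝ᵥ (G⁻¹ *ᵥ a) := by
    have : ∑ x, ∑ y, ξ x * F x y * ξ y = ∑ x, ∑ y, ξ x * (C * G⁻¹ * C) x y * ξ y :=
      Finset.sum_congr rfl fun x _ => Finset.sum_congr rfl fun y _ => by rw [h4]
    rw [this, sum_sum_eq_dotProduct_mulVec, ← Matrix.mulVec_mulVec, ← Matrix.mulVec_mulVec, hCξ,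
      dotProduct_mulVec_of_symm C hCsym, hCξ]
  have hmξ : m ⬝ᵥ ξ = a ⬝ᵥ (G⁻¹ *ᵥ a) := by
    rw [hm, dotProduct_comm, dotProduct_mulVec_of_symm C hCsym, hCξ]
  have h5 : a ⬝ᵥ (G⁻¹ *ᵥ a) = 2 * (m ⬝ᵥ ξ) - ∑ x, ∑ y, ξ x * F x y * ξ y := by
    rw [hquad, hmξ]
    ring
  -- (6) the backflow vector `m_y = −schur((L e_y)∘Θ, J) = σ_{y−1} − σ_y + γ[y ∈ ∂] τ_y`
  have hGa : ∀ y, ∑ u, ∑ v, G y u * G⁻¹ u v * a v = a y := by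
    intro y
    have h := congrFun (congrArg (fun M : Matrix (Fin N) (Fin N) ℝ => M *ᵥ a) hGG) y
    simp only [Matrix.one_mulVec] at h
    rw [← h, ← Matrix.mulVec_mulVec]
    simp only [Matrix.mulVec, dotProduct, Finset.mul_sum, mul_assoc]
  have hCa : ∀ y, ∑ u, ∑ v, C y u * G⁻¹ u v * a v = m y := by
    intro y
    simp only [hm, Matrix.mulVec, dotProduct, Finset.mul_sum, mul_assoc]
  have h6a : ∀ y, schur (Lr y) J = -m y := by
    intro y
    rw [hschur, hK4]
    have : ∀ u v, lap (Lr y) (e u) * G⁻¹ u v * lap (e v) J =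
        -(s * (G y u * G⁻¹ u v * a v)) + C y u * G⁻¹ u v * a v := by
      intro u v
      rw [hK1, hrev, ← hG, ← hC, ha]
      ring
    simp_rw [this]
    simp only [Finset.sum_add_distrib, Finset.sum_neg_distrib, ← Finset.mul_sum]
    rw [hGa, hCa, ha]
    ring
  have h6b : ∀ y, schur (Lr y) J =
      (∑ b, ((if b = y then 1 else 0) - (if y.val = b.val + 1 then 1 else 0)) * schur (j b) J) +
        (-(γ * ((if y.val = 0 then 1 else 0) + (if y.val = N - 1 then 1 else 0)))) *
          schur (psq y) J :=
    fun y => schur_lincomb lap schur e J G hschur _ _ (Lr y) (psq y) j (hLrJ y) (hLre y)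
  have h6 : ∀ y, m y = (∑ b : Fin N, if y.val = b.val + 1 then schur (j b) J else 0) -
      schur (j y) J + γ * (((if y.val = 0 then 1 else 0) + (if y.val = N - 1 then 1 else 0)) *
        schur (psq y) J) := by
    intro y
    have h := h6a y
    rw [h6b] at h
    have hsplit : (∑ b, ((if b = y then 1 else 0) - (if y.val = b.val + 1 then 1 else 0)) *
        schur (j b) J) = schur (j y) J - ∑ b : Fin N, if y.val = b.val + 1 then schur (j b) J else 0 := by
      simp only [sub_mul, Finset.sum_sub_distrib, ite_mul, one_mul, zero_mul]
      rw [Finset.sum_ite_eq' Finset.univ y, if_pos (Finset.mem_univ y)]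
    rw [hsplit] at h
    linarith
  -- (7) no current through the missing last bond
  have h7 : ∀ b : Fin N, ¬ b.val + 1 < N → schur (j b) J = 0 := by
    intro b hb
    rw [hschur, (hjN b hb).1]
    simp only [(hjN b hb).2, zero_mul, Finset.sum_const_zero, sub_zero]
  -- (8) the Robin optimisation
  have h8 : a ⬝ᵥ (G⁻¹ *ᵥ a) ≤ (1 / c) * ((∑ b : Fin N, if b.val + 1 < N then
      (schur (j b) J - k) ^ 2 else 0) + (γ * schur (psq ⟨0, by omega⟩) J - k) ^ 2 +
      (γ * schur (psq ⟨N - 1, by omega⟩) J + k) ^ 2) := by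
    have hR := hRobin ξ
    have hopt := robin_sup_bound hN hc γ k (fun b => schur (j b) J) (fun y => schur (psq y) J) ξ h7
    have hmdot : m ⬝ᵥ ξ = ∑ y, ((∑ b : Fin N, if y.val = b.val + 1 then schur (j b) J else 0) -
        schur (j y) J + γ * (((if y.val = 0 then 1 else 0) + (if y.val = N - 1 then 1 else 0)) *
          schur (psq y) J)) * ξ y := by
      simp only [dotProduct]
      exact Finset.sum_congr rfl fun y _ => by rw [h6]
    rw [h5, hmdot]
    linarith
  -- assembly
  rw [← h3, h1]
  constructor
  · linarith
  · linarith

end Circuit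

end Summit.AtomisticToContinuum.FouriersLaw.Theorems.HonestZwanzig.NetworkReduction
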